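import Summits.QuantumFields.YangMills.Theorems.UnitScaleTiltProp7NSOfParallelTopMean
import HarnessLib

/-!
# Route `UnitScaleTilt`, crux K1 «MinimiserStabilityRegPr» (stmt-QuantumFields-19200), EX positivity block — **THE INTRINSIC INTERTWINER OF THE AVERAGING OF RECORD:
# `Q(U₀)(D_{U₀}λ) = D′(Q″λ)` with `Q″ =` THE TOP NESTED COVARIANT MEAN (frame tower of `QTwS`), AS A LINEAR MAP** — [Balaban1985BackgroundPropagators] (3.114)–(3.115) p.418
# «`Q_jDλ = D_jQ′_jλ`» for the symmetric re-based chart of record, i.e. the `(Q″, D′)` that ✓`Prop7PosMonotoneInProjector.ker_le_NS_of_intertwining` (✓p733476 §4) asks for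

Cell `ym3-torus` (HUMAN RULING D-0037; rung R3 — NOT d = 4, NOT infinite volume, NOT a mass gap, NOT Clay).  Width seat `ym3-torus-px13` (gen 9); ★p1 g21 2026-08-29T17:04:04Z «GO (B′)
after (N)».  THEOREMS ONLY (0 `def`, 0 `sorry`); `--supports stmt-QuantumFields-19200 --as helper`; count-neutral.  Nothing of [B9] §3, N06, `hThm2S`, EX or the crux is asserted.

THE POINT.  ✓`Prop7SymAvgTwSGaugeDir.QTwS_gaugeDir_of_avgSeq` gives (3.19) in closed form for ANY averaging sequence `ns` of `λ` (the `h0`∕`hsucc` `meanCLM` recursion with the frame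
transports `holT (emlIterU j U₀♭) (emb y) (stairWord σ (off r))`): `QTwS U₀ (D_{U₀}λ) = D_{Ū₀}(ns_{K−n})`.  The recursion is LINEAR and DETERMINISTIC, so `λ ↦ ns_{K−n}λ` is ONE linear map
`Q″` (§1: `exists_linear_avgSeq`, `avgSeq_unique`), and with ★px20's (3.3) stencil `toL2_symm_DL2_toL2S_eq` the `L²` letters read `QL2 U₀ (DL2 U₀ l) = D′ (Q″ l)`,
`D′ c := toL2B (−η⁻¹ • (c(ê₋) − Ū₀(ê)c(ê₊)Ū₀(ê)⁻¹))` (§2).  Consequences packaged in the same `∃`: `ker Q″ ≤ N_S(U₀)` (the `hker` of ✓p733476 §4 `projR_hyps_of_ker_le` ∕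
`pos_laplaceA_of_pos_projR` — so `projR (covLapSite U₀) Q″` IS a print-shape projector dominated by `R_S(U₀)`), and every averaging sequence of `λ` has top `Q″(toL2S λ)`.
CONTRAST (✓`Prop7KerCombNotLeNS`, this seat): print's based `ℤ³` comb `QprimeCombL2` is NOT such a `Q″` (`ker ⊄ N_S` already at `U₀ = 1`).

WHAT IS PROVED (ns `…Theorems.Prop7NSIntertwinerOfRecord`):
* §1 (generic `P`, complete normed `ℂ`-algebra `𝔸`, any transports `T j y i`) `avgSeq_unique` (two averaging sequences with the same start agree at every level), ★`exists_linear_avgSeq`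
  (the recursion is realised by linear maps `N j : (Site P 0 → 𝔸) →ₗ[ℂ] (Site P j → 𝔸)`, `N 0 = id`).
* §2 (T³ member, `U₀ ∈ 𝔘_k(ε₀)`, `10¹²L³ε₀ ≤ 1`) ★★★ `exists_intertwiner_of_regPr` — `∃ Q″ D′`, (i) `∀ l, QL2 U₀ (DL2 U₀ l) = D′ (Q″ l)`; (ii) `D′`'s formula; (iii) every averaging sequence of `λ`
  has `ns (K−n) = Q″ (toL2S λ)`; (iv) an averaging sequence exists; (v) `LinearMap.ker Q″ ≤ NS F n K h c₀ cB U₀`.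
HONEST SCOPE.  Bookkeeping over landed letters (the analytic input is ✓`differentiableAt_logChartTwS_of_regPr` by name); no estimate; zero twin with ✓`Prop7NSOfParallelTopMean` (which
characterises the kernel for a GIVEN sequence; here the sequence is packaged as a linear operator with its intertwiner).  Rung R3, not Clay; YM gap NOT proved.

References: T. Bałaban, CMP **99** (1985) 389–434 [Balaban1985BackgroundPropagators] ((3.3) p.391, (3.19) p.393, (3.21) p.394, (3.114)–(3.115) p.418); CMP **98** (1985) 17–51
[Balaban1985Averaging] ((97) p.32).
-/

set_option autoImplicit false

noncomputable section

open scoped BigOperators Matrix.Norms.L2Operator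

namespace Summit.QuantumFields.YangMills.Theorems.Prop7NSIntertwinerOfRecord

open NormedSpace
open Literature.MathematicalPhysics.QuantumFieldTheory.Balaban1983to89
open Literature.MathematicalPhysics.QuantumFieldTheory.Balaban1983to89.T3ContinuumYM3Torus
open T4Continuum BlockAveraging
open BlockAveraging (Idx)
open B7Prop1Explicit (disp)
open B7Eq78Linearization (conjR conjR_apply)
open B10Eq27TorusAxialLog (holT transl)
open B7TransferAnalyticMean (meanCLM)
open B9Eq311L2Pairing (WL2)
open B11Eq103H1Complex (SiteL2K)
open Summit.QuantumFields.YangMills.Theorems.Prop8Chart (emlIterU)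
open T3PrintedRegularMinimiser (RegPr)
open T3PrintedRegularOrbits (sites_eq)
open T3LevelShift (bondShift)
open T3SectALandauChart (bgUnits eta eta_pos)
open Summit.QuantumFields.YangMills.Theorems.Prop7SectET3Transport (periodsT3)
open Summit.QuantumFields.YangMills.Theorems.Prop7SectET3HilbertLetters (W₂ toL2 toL2S toL2B QL2 DL2 QL2_toL2)
open Summit.QuantumFields.YangMills.Theorems.Prop7SectET3GaugeProjector (NS mem_NS_iff)
open Summit.QuantumFields.YangMills.Theorems.Prop7SymAvgTwSym (QTwS logChartTwS differentiableAt_logChartTwS_of_regPr)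
open Summit.QuantumFields.YangMills.Theorems.Prop7SymAvgTwSGaugeDir (QTwS_gaugeDir_of_avgSeq)
open Summit.QuantumFields.YangMills.Theorems.Prop7NestedMeanParallelLift (toL2_symm_DL2_toL2S_eq)

/-! ## §1 The averaging-sequence recursion is deterministic and linear -/

section Recursion

variable {P : Params} {𝔸 : Type*} [NormedRing 𝔸] [NormedAlgebra ℂ 𝔸]

/-- **TWO AVERAGING SEQUENCES WITH THE SAME START AGREE AT EVERY LEVEL** (the `meanCLM` recursion of ✓`QTwS_gaugeDir_of_avgSeq` determines `ns (j+1)` from `ns j`).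
[cite: Balaban1985BackgroundPropagators, (3.19) p.393] -/
theorem avgSeq_unique (T : (j : ℕ) → Site P (j + 1) → Idx P → 𝔸ˣ) (ns ns' : (j : ℕ) → Site P j → 𝔸) (h0 : ns 0 = ns' 0)
    (hns : ∀ (j : ℕ) (y : Site P (j + 1)), ns (j + 1) y = ns j (emb y) - meanCLM (Idx P) 𝔸 fun i : Idx P =>
        ns j (emb y) - ((T j y i : 𝔸ˣ) : 𝔸) * ns j (transl (emb y) (disp (stairWord i.2.1 (off i.1)))) * (((T j y i)⁻¹ : 𝔸ˣ) : 𝔸))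
    (hns' : ∀ (j : ℕ) (y : Site P (j + 1)), ns' (j + 1) y = ns' j (emb y) - meanCLM (Idx P) 𝔸 fun i : Idx P =>
        ns' j (emb y) - ((T j y i : 𝔸ˣ) : 𝔸) * ns' j (transl (emb y) (disp (stairWord i.2.1 (off i.1)))) * (((T j y i)⁻¹ : 𝔸ˣ) : 𝔸)) :
    ∀ j : ℕ, ns j = ns' j
  | 0 => h0
  | j + 1 => by
    funext y
    rw [hns, hns', avgSeq_unique T ns ns' h0 hns hns' j]

/-- ★ **THE RECURSION IS REALISED BY LINEAR MAPS**: for any transports `T j y i` there are `ℂ`-linear `N j : (Site P 0 → 𝔸) →ₗ[ℂ] (Site P j → 𝔸)` with `N 0 λ = λ` and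
`N (j+1) λ y = N j λ ŷ − mean_i (N j λ ŷ − T·N j λ (x_i)·T⁻¹)` — so `j ↦ N j λ` is THE averaging sequence of `λ` (`avgSeq_unique`). [cite: Balaban1985BackgroundPropagators, (3.19) p.393; Balaban1985Averaging, (97) p.32] -/
theorem exists_linear_avgSeq (T : (j : ℕ) → Site P (j + 1) → Idx P → 𝔸ˣ) :
    ∃ N : (j : ℕ) → ((Site P 0 → 𝔸) →ₗ[ℂ] (Site P j → 𝔸)),
      (∀ l : Site P 0 → 𝔸, N 0 l = l) ∧
      ∀ (j : ℕ) (l : Site P 0 → 𝔸) (y : Site P (j + 1)), N (j + 1) l y = N j l (emb y) - meanCLM (Idx P) 𝔸 fun i : Idx P =>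
        N j l (emb y) - ((T j y i : 𝔸ˣ) : 𝔸) * N j l (transl (emb y) (disp (stairWord i.2.1 (off i.1)))) * (((T j y i)⁻¹ : 𝔸ˣ) : 𝔸) := by
  -- the one-step map is linear
  have step : ∀ j : ℕ, ∃ S : (Site P j → 𝔸) →ₗ[ℂ] (Site P (j + 1) → 𝔸), ∀ (f : Site P j → 𝔸) (y : Site P (j + 1)),
      S f y = f (emb y) - meanCLM (Idx P) 𝔸 fun i : Idx P =>
        f (emb y) - ((T j y i : 𝔸ˣ) : 𝔸) * f (transl (emb y) (disp (stairWord i.2.1 (off i.1)))) * (((T j y i)⁻¹ : 𝔸ˣ) : 𝔸) := by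
    intro j
    refine ⟨{ toFun := fun f y => f (emb y) - meanCLM (Idx P) 𝔸 fun i : Idx P =>
                f (emb y) - ((T j y i : 𝔸ˣ) : 𝔸) * f (transl (emb y) (disp (stairWord i.2.1 (off i.1)))) * (((T j y i)⁻¹ : 𝔸ˣ) : 𝔸)
              map_add' := ?_
              map_smul' := ?_ }, fun f y => rfl⟩
    · intro f g
      funext y
      have hfun : (fun i : Idx P => f (emb y) + g (emb y) - ((T j y i : 𝔸ˣ) : 𝔸) *
            (f (transl (emb y) (disp (stairWord i.2.1 (off i.1)))) + g (transl (emb y) (disp (stairWord i.2.1 (off i.1))))) * (((T j y i)⁻¹ : 𝔸ˣ) : 𝔸))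
          = (fun i : Idx P => f (emb y) - ((T j y i : 𝔸ˣ) : 𝔸) * f (transl (emb y) (disp (stairWord i.2.1 (off i.1)))) * (((T j y i)⁻¹ : 𝔸ˣ) : 𝔸))
            + (fun i : Idx P => g (emb y) - ((T j y i : 𝔸ˣ) : 𝔸) * g (transl (emb y) (disp (stairWord i.2.1 (off i.1)))) * (((T j y i)⁻¹ : 𝔸ˣ) : 𝔸)) := by
        funext i
        simp only [Pi.add_apply, mul_add, add_mul]
        abel
      simp only [Pi.add_apply]
      rw [hfun, map_add]
      abel
    · intro c f
      funext y
      have hfun : (fun i : Idx P => c • f (emb y) - ((T j y i : 𝔸ˣ) : 𝔸) * (c • f (transl (emb y) (disp (stairWord i.2.1 (off i.1))))) * (((T j y i)⁻¹ : 𝔸ˣ) : 𝔸))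
          = c • (fun i : Idx P => f (emb y) - ((T j y i : 𝔸ˣ) : 𝔸) * f (transl (emb y) (disp (stairWord i.2.1 (off i.1)))) * (((T j y i)⁻¹ : 𝔸ˣ) : 𝔸)) := by
        funext i
        simp only [Pi.smul_apply, smul_sub, mul_smul_comm, smul_mul_assoc]
      simp only [Pi.smul_apply, RingHom.id_apply]
      rw [hfun, map_smul, smul_sub]
  choose S hS using step
  refine ⟨fun j => Nat.rec (motive := fun j => (Site P 0 → 𝔸) →ₗ[ℂ] (Site P j → 𝔸)) LinearMap.id (fun j Nj => (S j).comp Nj) j,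
    fun l => rfl, fun j l y => ?_⟩
  exact hS j _ y

end Recursion

/-! ## §2 At the T³ member: the intrinsic intertwiner `(Q″, D′)` of the averaging of record -/

section T3

variable (F : T3Family) {n K : ℕ}

/-- ★★★ **THE INTRINSIC INTERTWINER OF THE AVERAGING OF RECORD.**  At a printed-regular background `U₀ ∈ 𝔘_k(ε₀)` (`10¹²L³ε₀ ≤ 1`) there are `ℂ`-linear
`Q″ : L²(gauge parameters) → (T^{(K−n)} → M₂)` — the TOP NESTED COVARIANT MEAN of the frame tower of `QTwS` — and `D′ : (T^{(K−n)} → M₂) → L²(coarse one-forms)` with: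
(i) `QL2 U₀ (DL2 U₀ l) = D′ (Q″ l)` for every `l` ([B9] (3.114)–(3.115) «`Q_kDλ = D_kQ′_kλ`» for the averaging of record); (ii) `D′ c = toL2B (−η⁻¹ • (e ↦ c(ê₋) − Ū₀(ê)c(ê₊)Ū₀(ê)⁻¹))`,
`ê = bondShift e`, `Ū₀ = emlIterU (K−n) U₀♭`; (iii) EVERY averaging sequence `ns` of `λ` (`h0`∕`hsucc` of ✓`QTwS_gaugeDir_of_avgSeq`) has `ns (K−n) = Q″ (toL2S λ)`; (iv) such a sequence
exists; (v) `ker Q″ ≤ N_S(U₀)` — the `hker` of ✓`Prop7PosMonotoneInProjector.projR_hyps_of_ker_le`, so `projR (covLapSite U₀) Q″` is dominated by `R_S(U₀)`.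
[cite: Balaban1985BackgroundPropagators, (3.114)-(3.115) p.418, (3.19) p.393, (3.21) p.394, (3.3) p.391; Balaban1985Averaging, (97) p.32] -/
theorem exists_intertwiner_of_regPr (h : n ≤ K) {c₀ : ℝ} [Fact (0 < c₀)] (cB : ℝ) {ε₀ : ℝ} (hε₀ : 0 < ε₀) (hWε : 10 ^ 12 * (F.L : ℝ) ^ 3 * ε₀ ≤ 1)
    (U₀ : GaugeField (F.P K) 0 (Matrix.specialUnitaryGroup (Fin 2) ℂ)) (hreg : RegPr F n K ε₀ U₀) :
    ∃ (Q'' : SiteL2K ℂ 3 (periodsT3 F K) c₀ W₂ →ₗ[ℂ] (Site (F.P K) (K - n) → Matrix (Fin 2) (Fin 2) ℂ))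
      (D' : (Site (F.P K) (K - n) → Matrix (Fin 2) (Fin 2) ℂ) →ₗ[ℂ] WL2 ℂ (fun _ : PBond (F.P n) 0 => cB) W₂),
      (∀ l, QL2 F n K h c₀ cB U₀ (DL2 F n K c₀ U₀ l) = D' (Q'' l)) ∧
      (∀ c : Site (F.P K) (K - n) → Matrix (Fin 2) (Fin 2) ℂ, D' c = toL2B F n cB (fun e : PBond (F.P n) 0 =>
        (((-(eta F n K)⁻¹ : ℝ) : ℂ)) • (c (bondShift (sites_eq F n K h) e).src
          - ((emlIterU (K - n) (bgUnits F K U₀) (bondShift (sites_eq F n K h) e) : (Matrix (Fin 2) (Fin 2) ℂ)ˣ) : Matrix (Fin 2) (Fin 2) ℂ) * c (bondShift (sites_eq F n K h) e).tgt *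
            (((emlIterU (K - n) (bgUnits F K U₀) (bondShift (sites_eq F n K h) e))⁻¹ : (Matrix (Fin 2) (Fin 2) ℂ)ˣ) : Matrix (Fin 2) (Fin 2) ℂ)))) ∧
      (∀ (lam : Site (F.P K) 0 → Matrix (Fin 2) (Fin 2) ℂ) (ns : (j : ℕ) → Site (F.P K) j → Matrix (Fin 2) (Fin 2) ℂ), ns 0 = lam →
        (∀ (j : ℕ) (y : Site (F.P K) (j + 1)), ns (j + 1) y = ns j (emb y) - meanCLM (Idx (F.P K)) (Matrix (Fin 2) (Fin 2) ℂ) fun i : Idx (F.P K) =>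
          ns j (emb y) - ((holT (emlIterU j (bgUnits F K U₀)) (emb y) (stairWord i.2.1 (off i.1)) : (Matrix (Fin 2) (Fin 2) ℂ)ˣ) : Matrix (Fin 2) (Fin 2) ℂ) *
            ns j (transl (emb y) (disp (stairWord i.2.1 (off i.1)))) * (((holT (emlIterU j (bgUnits F K U₀)) (emb y) (stairWord i.2.1 (off i.1)))⁻¹ : (Matrix (Fin 2) (Fin 2) ℂ)ˣ) : Matrix (Fin 2) (Fin 2) ℂ)) →
        ns (K - n) = Q'' (toL2S F K c₀ lam)) ∧
      (∀ lam : Site (F.P K) 0 → Matrix (Fin 2) (Fin 2) ℂ, ∃ ns : (j : ℕ) → Site (F.P K) j → Matrix (Fin 2) (Fin 2) ℂ, ns 0 = lam ∧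
        (∀ (j : ℕ) (y : Site (F.P K) (j + 1)), ns (j + 1) y = ns j (emb y) - meanCLM (Idx (F.P K)) (Matrix (Fin 2) (Fin 2) ℂ) fun i : Idx (F.P K) =>
          ns j (emb y) - ((holT (emlIterU j (bgUnits F K U₀)) (emb y) (stairWord i.2.1 (off i.1)) : (Matrix (Fin 2) (Fin 2) ℂ)ˣ) : Matrix (Fin 2) (Fin 2) ℂ) *
            ns j (transl (emb y) (disp (stairWord i.2.1 (off i.1)))) * (((holT (emlIterU j (bgUnits F K U₀)) (emb y) (stairWord i.2.1 (off i.1)))⁻¹ : (Matrix (Fin 2) (Fin 2) ℂ)ˣ) : Matrix (Fin 2) (Fin 2) ℂ)) ∧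
        ns (K - n) = Q'' (toL2S F K c₀ lam)) ∧
      LinearMap.ker Q'' ≤ NS F n K h c₀ cB U₀ := by
  -- the frame transports and the linear tower
  set T : (j : ℕ) → Site (F.P K) (j + 1) → Idx (F.P K) → (Matrix (Fin 2) (Fin 2) ℂ)ˣ :=
    fun j y i => holT (emlIterU j (bgUnits F K U₀)) (emb y) (stairWord i.2.1 (off i.1)) with hTdef
  obtain ⟨N, hN0, hNsucc⟩ := exists_linear_avgSeq (P := F.P K) (𝔸 := Matrix (Fin 2) (Fin 2) ℂ) T
  -- the coarse covariant derivative, scaled by `−η⁻¹`, read on `L²`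
  have hcoarse : ∃ Dc : (Site (F.P K) (K - n) → Matrix (Fin 2) (Fin 2) ℂ) →ₗ[ℂ] (PBond (F.P n) 0 → Matrix (Fin 2) (Fin 2) ℂ),
      ∀ c e, Dc c e = (((-(eta F n K)⁻¹ : ℝ) : ℂ)) • (c (bondShift (sites_eq F n K h) e).src
        - ((emlIterU (K - n) (bgUnits F K U₀) (bondShift (sites_eq F n K h) e) : (Matrix (Fin 2) (Fin 2) ℂ)ˣ) : Matrix (Fin 2) (Fin 2) ℂ) * c (bondShift (sites_eq F n K h) e).tgt *
          (((emlIterU (K - n) (bgUnits F K U₀) (bondShift (sites_eq F n K h) e))⁻¹ : (Matrix (Fin 2) (Fin 2) ℂ)ˣ) : Matrix (Fin 2) (Fin 2) ℂ)) := by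
    refine ⟨{ toFun := fun c e => (((-(eta F n K)⁻¹ : ℝ) : ℂ)) • (c (bondShift (sites_eq F n K h) e).src
                - ((emlIterU (K - n) (bgUnits F K U₀) (bondShift (sites_eq F n K h) e) : (Matrix (Fin 2) (Fin 2) ℂ)ˣ) : Matrix (Fin 2) (Fin 2) ℂ) * c (bondShift (sites_eq F n K h) e).tgt *
                  (((emlIterU (K - n) (bgUnits F K U₀) (bondShift (sites_eq F n K h) e))⁻¹ : (Matrix (Fin 2) (Fin 2) ℂ)ˣ) : Matrix (Fin 2) (Fin 2) ℂ))
              map_add' := ?_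
              map_smul' := ?_ }, fun c e => rfl⟩
    · intro c c'
      funext e
      simp only [Pi.add_apply, mul_add, add_mul, smul_add, smul_sub]
      abel
    · intro a c
      funext e
      simp only [Pi.smul_apply, RingHom.id_apply, smul_sub, mul_smul_comm, smul_mul_assoc, smul_comm a]
  obtain ⟨Dc, hDc⟩ := hcoarse
  -- the two maps
  refine ⟨(N (K - n)).comp (toL2S F K c₀).symm.toLinearMap, (toL2B F n cB).toLinearMap.comp Dc, ?_, ?_, ?_, ?_, ?_⟩
  · -- (i) the intertwining identity
    intro l
    obtain ⟨lam, rfl⟩ : ∃ lam : Site (F.P K) 0 → Matrix (Fin 2) (Fin 2) ℂ, l = toL2S F K c₀ lam :=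
      ⟨(toL2S F K c₀).symm l, ((toL2S F K c₀).apply_symm_apply l).symm⟩
    have hS := differentiableAt_logChartTwS_of_regPr F h hε₀ hWε U₀ hreg
    have hQ := QTwS_gaugeDir_of_avgSeq F h U₀ hS lam (fun j => N j lam) (hN0 lam) (fun j y => hNsucc j lam y)
    -- the gauge direction of `λ` is `−η•G`, `G` the (3.3) stencil of `toL2S λ`
    set G : PBond (F.P K) 0 → Matrix (Fin 2) (Fin 2) ℂ := (toL2 F K c₀).symm (DL2 F n K c₀ U₀ (toL2S F K c₀ lam)) with hGdef
    have hη : ((eta F n K : ℝ) : ℂ) ≠ 0 := by exact_mod_cast (eta_pos F n K).ne'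
    have hdir : (fun b : PBond (F.P K) 0 => lam b.src - ((bgUnits F K U₀ b : (Matrix (Fin 2) (Fin 2) ℂ)ˣ) : Matrix (Fin 2) (Fin 2) ℂ) * lam b.tgt *
        (((bgUnits F K U₀ b)⁻¹ : (Matrix (Fin 2) (Fin 2) ℂ)ˣ) : Matrix (Fin 2) (Fin 2) ℂ)) = (-((eta F n K : ℝ) : ℂ)) • G := by
      rw [hGdef, toL2_symm_DL2_toL2S_eq]
      funext b
      simp only [Pi.smul_apply, smul_smul, neg_mul, mul_inv_cancel₀ hη, neg_smul, one_smul, neg_sub, conjR_apply]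
    have hGQ : QTwS F n K h U₀ G = (((-(eta F n K)⁻¹ : ℝ) : ℂ)) • QTwS F n K h U₀ (fun b : PBond (F.P K) 0 =>
        lam b.src - ((bgUnits F K U₀ b : (Matrix (Fin 2) (Fin 2) ℂ)ˣ) : Matrix (Fin 2) (Fin 2) ℂ) * lam b.tgt *
          (((bgUnits F K U₀ b)⁻¹ : (Matrix (Fin 2) (Fin 2) ℂ)ˣ) : Matrix (Fin 2) (Fin 2) ℂ)) := by
      rw [hdir, map_smul, smul_smul]
      have hone : (((-(eta F n K)⁻¹ : ℝ) : ℂ)) * (-((eta F n K : ℝ) : ℂ)) = 1 := by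
        rw [Complex.ofReal_neg, Complex.ofReal_inv, neg_mul_neg, inv_mul_cancel₀ hη]
      rw [hone, one_smul]
    have h2 : DL2 F n K c₀ U₀ (toL2S F K c₀ lam) = toL2 F K c₀ G := by rw [hGdef, LinearEquiv.apply_symm_apply]
    rw [h2, QL2_toL2, hGQ, hQ]
    show _ = toL2B F n cB (Dc (N (K - n) ((toL2S F K c₀).symm (toL2S F K c₀ lam))))
    rw [LinearEquiv.symm_apply_apply]
    congr 1
    funext e
    rw [hDc, Pi.smul_apply]
  · -- (ii) the formula of `D′`
    intro c
    show toL2B F n cB (Dc c) = _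
    congr 1
    funext e
    exact hDc c e
  · -- (iii) every averaging sequence has this top
    intro lam ns h0 hsucc
    have hu := avgSeq_unique T ns (fun j => N j lam) (by rw [h0, hN0]) hsucc (fun j y => hNsucc j lam y) (K - n)
    rw [hu]
    show N (K - n) lam = N (K - n) ((toL2S F K c₀).symm (toL2S F K c₀ lam))
    rw [LinearEquiv.symm_apply_apply]
  · -- (iv) existence of an averaging sequence
    intro lam
    refine ⟨fun j => N j lam, hN0 lam, fun j y => hNsucc j lam y, ?_⟩
    show N (K - n) lam = N (K - n) ((toL2S F K c₀).symm (toL2S F K c₀ lam))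
    rw [LinearEquiv.symm_apply_apply]
  · -- (v) `ker Q″ ≤ N_S(U₀)`: a vanishing top mean is parallel
    intro l hl
    obtain ⟨lam, rfl⟩ : ∃ lam : Site (F.P K) 0 → Matrix (Fin 2) (Fin 2) ℂ, l = toL2S F K c₀ lam :=
      ⟨(toL2S F K c₀).symm l, ((toL2S F K c₀).apply_symm_apply l).symm⟩
    have hk : N (K - n) ((toL2S F K c₀).symm (toL2S F K c₀ lam)) = 0 := LinearMap.mem_ker.1 hl
    rw [LinearEquiv.symm_apply_apply] at hk
    have htop : ∀ y : Site (F.P K) (K - n), N (K - n) lam y = 0 := fun y => by rw [hk]; rfl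
    exact Prop7NSOfParallelTopMean.mem_NS_of_topMean_eq_zero F h cB hε₀ hWε U₀ hreg (fun j => N j lam) lam (hN0 lam) (fun j y => hNsucc j lam y) htop

end T3

end Summit.QuantumFields.YangMills.Theorems.Prop7NSIntertwinerOfRecord

end
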